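import Summits.CriticalPhenomena.PercolationContinuityZ3.Theorems.PercNearOneGluingNoHeavyLowerTailSahiCombMixFourMain
import Summits.CriticalPhenomena.PercolationContinuityZ3.Theorems.PercNearOneGluingNoHeavyLowerTailSahiCombMixCoinTransfer
import Summits.CriticalPhenomena.PercolationContinuityZ3.Theorems.PercNearOneGluingNoHeavyLowerTailSahiCombMixGrow

/-!
# The comb hierarchy for Sahi's `E_k`, LX: OR-ing a fresh coordinate into ONE of five events — everything except three order-4 cells is a theorem
# (orders ≤ 3 are comb H-MIX(4) on a derived quadruple; order 5 is affine; the conditional assembly `combHereditary_orCoord_five_single_of_cells`)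

Support file of the one-cut programme (crux `NoHeavyLowerTail`, stmt-CriticalPhenomena-4575; cell `prim-masterthm`, seat P3, gen 10;
`run/shared/lean/prim/prim-masterthm/prim-masterthm-p3/HIERARCHY.md` §18(h),(k)).  At `n = 5` the OR step into `≥ 3` members is false already at the law level
(`…SahiMixtureSingletonFiveThree`) and into `2` members only the top cell is known (`combPos_five_orCoord_two`); this file isolates what the step into ONE member needs.
REDUCTION.  With `V = U_i ∪ {e ∈ ω}` the OR-ed family is `(V, U_j)_{j≠i}`; a row with slots `K_0,…,K_{m−1}` only involves the `(m+1)`-family `(U_i, Q_0, …, Q_{m−1})`,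
`Q_a = ⋂_{l ∈ K_a ∖ i} U_l`, which is again `CombHereditary` (`CombHereditary.of_eq_biInter`) — so
* orders `m ≤ 3`: the row is a row of the OR-ed DERIVED QUADRUPLE `(U_i, Q_0, Q_1, Q_2)` with `e` OR-ed into member `0`: comb H-MIX(4) (`combHereditary_orCoord_four`, gen 8);
* order `m = 5`: irredundant ⇒ singleton slots ⇒ ONE touched slot ⇒ the cell is AFFINE in `p_e`: `(1−p_e)·E_5(U) + 3p_e·E_4(U_{≠i})` (`sahiE_five_orCoin_one_eq`,
  `combPos_five_orCoord_one`);
* order `m = 4`: the interface `CombFiveSingleFourSlotCells` (all order-4 rows of a `CombHereditary` quintuple with `e` OR-ed into member `0`; by the same reduction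
  only the three classes `(U_01,U_02,U_3,U_4)`, `(U_01,U_02,U_03,U_4)`, `(U_01,U_02,U_03,U_04)` with `e` OR-ed into `U_0` are not affine — classes 159/173/186 of the gen-8
  census, SLSQP-clean on `𝒦_5`; ttrl's her5 fold has exactly one `q = 1`/L1-infeasible coefficient among them, `c_1` of the last: requests l.1573/1598).
RESULT: **`combHereditary_orCoord_five_single_of_cells`** — under that interface, OR-ing a fresh coordinate into one member of any `CombHereditary` quintuple of increasing
events keeps it `CombHereditary`; `m = 2` from the hereditary covariances (`combPos_two_mixCoord`), `m = 3` by comb H-MIX(4) on the derived quadruple, `m = 4` the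
interface (events relabelled by `swap 0 i`), `m = 5` affine.  HONEST FRAMING: conditional on the interface; nothing here asserts (M⁺-k) or `C_k` for `k ≥ 3`. [this work]
-/

noncomputable section

open scoped Classical

namespace Summit.CriticalPhenomena.PercolationContinuityZ3.Theorems

open Finset Function
open Literature.Combinatorics.Sahi2008
open Literature.Probability.Percolation.DecisionTree (ind ind_of_mem ind_of_not_mem ind_nonneg)
open SahiComb
open SahiMixture (Irredundant)
open SahiCombDisjunct (orCoord)
open SahiCombHereditary (CombHereditary combHereditary_of_irredundant exists_perm_of_irredundant isUpperSet_biInter)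

variable {ι : Type} [Fintype ι]

namespace SahiCombMix

/-! ### The selector "OR into member `i` only" and the members of the OR-ed family -/

/-- The selector OR-ing the coordinate into member `i` only. [this work] -/
def sel {n : ℕ} (i : Fin n) : Fin n → Bool := fun j => decide (j = i)

omit [Fintype ι] in
/-- Untouched members. [this work] -/
theorem orCoord_sel_of_ne {n : ℕ} (U : Fin n → Set (Set ι)) (e : ι) {i l : Fin n} (hl : l ≠ i) : orCoord U e (sel i) l = U l := by
  unfold SahiCombDisjunct.orCoord sel
  rw [decide_eq_false hl]
  rfl

omit [Fintype ι] in
/-- The touched member. [this work] -/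
theorem orCoord_sel_self {n : ℕ} (U : Fin n → Set (Set ι)) (e : ι) (i : Fin n) : orCoord U e (sel i) i = U i ∪ {ω : Set ι | e ∈ ω} := by
  unfold SahiCombDisjunct.orCoord sel
  rw [decide_eq_true rfl]
  rfl

omit [Fintype ι] in
/-- Members of the ∩-closed family over index sets avoiding `i` are the old members. [this work] -/
theorem biInter_orCoord_sel_erase {n : ℕ} (U : Fin n → Set (Set ι)) (e : ι) (i : Fin n) (K : Finset (Fin n)) :
    (⋂ l ∈ K.erase i, orCoord U e (sel i) l) = ⋂ l ∈ K.erase i, U l :=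
  Set.iInter_congr fun l => Set.iInter_congr fun hl => by rw [orCoord_sel_of_ne U e (Finset.ne_of_mem_erase hl)]

omit [Fintype ι] in
/-- **Members of the ∩-closed family of the single-OR-ed family**: `⋂_{l∈K}(…) = (⋂_{l ∈ K∖i} U_l) ∩ [i ∈ K](U_i ∪ {e ∈ ω})`. [this work] -/
theorem biInter_orCoord_sel {n : ℕ} (U : Fin n → Set (Set ι)) (e : ι) (i : Fin n) (K : Finset (Fin n)) :
    (⋂ l ∈ K, orCoord U e (sel i) l)
      = (⋂ l ∈ K.erase i, U l) ∩ (if i ∈ K then U i ∪ {ω : Set ι | e ∈ ω} else Set.univ) := by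
  by_cases hi : i ∈ K
  · rw [if_pos hi]
    conv_lhs => rw [← Finset.insert_erase hi]
    rw [Finset.set_biInter_insert, biInter_orCoord_sel_erase, orCoord_sel_self, Set.inter_comm]
  · rw [if_neg hi, Set.inter_univ, ← biInter_orCoord_sel_erase U e i K, Finset.erase_eq_of_notMem hi]

/-! ### The interface: the order-4 rows -/

/-- **Interface: the order-4 rows of a quintuple with `e` OR-ed into member `0`** are comb-positive at multidegree `4`, for every finite cube and every `CombHereditary`
quintuple of increasing events ignoring `e`.  (By the reduction of this file only the three non-affine classes `(U_01,U_02,U_3,U_4)`, `(U_01,U_02,U_03,U_4)`,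
`(U_01,U_02,U_03,U_04)` are substantive; NOT proved here.) [this work] -/
def CombFiveSingleFourSlotCells : Prop :=
  ∀ (ι : Type) [Fintype ι] (W : Fin 5 → Set (Set ι)) (e : ι), (∀ j, IsUpperSet (W j)) → (∀ (j : Fin 5) (b : Bool), secAt e b (W j) = W j) →
    CombHereditary W → ∀ (K : Fin 4 → Finset (Fin 5)),
      CombPos (fun _ : ι => 4) (fun p => sahiE (bernoulliWeight p) 4 (fun j => ind (⋂ l ∈ K j, orCoord W e (sel 0) l)))

/-! ### Order 5: one touched slot, an affine cell -/

set_option maxHeartbeats 1600000 in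
/-- **The (5,1) singleton identity** (any weight, any five events, independent coin of bias `h`): `E_5(A_0∪H, A_1, A_2, A_3, A_4) = (1−h)·E_5(A) + 3h·E_4(A_1,A_2,A_3,A_4)`
(only one slot depends on the coin, so the cell is affine; at `h = 1` Sahi's branching `E_5(Ω, g) = 3E_4(g)`). [this work] -/
theorem sahiE_five_orCoin_one_eq {α : Type*} [Fintype α] {μ : α → ℝ} (hμ1 : ∑ a, μ a = 1) (A0 A1 A2 A3 A4 : Set α) (h : ℝ) :
    sahiE (SahiMixture.coinWeight μ h) 5
        ![ind (SahiMixture.orCoin A0 true), ind (SahiMixture.orCoin A1 false), ind (SahiMixture.orCoin A2 false), ind (SahiMixture.orCoin A3 false),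
          ind (SahiMixture.orCoin A4 false)]
      = (1 - h) * sahiE μ 5 ![ind A0, ind A1, ind A2, ind A3, ind A4] + h * (3 * sahiE μ 4 ![ind A1, ind A2, ind A3, ind A4]) := by
  rw [sahiE_five, sahiE_five, sahiE_four]
  simp only [SahiMixture.exc_or₅, SahiMixture.exc_or₄, SahiMixture.exc_or₃, SahiMixture.exc_or₂, SahiMixture.exc_or₁ μ h hμ1, cond_true, cond_false,
    one_mul, mul_one]
  ring

section Five

variable (U : Fin 5 → Set (Set ι)) (e : ι) (hUe : ∀ (j : Fin 5) (b : Bool), secAt e b (U j) = U j)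
include hUe

/-- **The comb (5,1) singleton cell**: OR-ing `e` into `U_0` only, the top row `E_5` is comb-positive at multidegree `5` — `(1−p_e)·E_5(U) + 3p_e·E_4(U_1,…,U_4)` with
both rows comb-positive off `e`. [this work] -/
theorem combPos_five_orCoord_one (hU : CombHereditary U) :
    CombPos (fun _ : ι => 5) (fun p => sahiE (bernoulliWeight p) 5 (fun j => ind (orCoord U e (sel 0) j))) := by
  have eU : (fun j => ind (⋂ i ∈ (![({0} : Finset (Fin 5)), {1}, {2}, {3}, {4}] : Fin 5 → Finset (Fin 5)) j, U i))
      = ![ind (U 0), ind (U 1), ind (U 2), ind (U 3), ind (U 4)] := by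
    funext j; fin_cases j <;> simp
  have eV : (fun j => ind (⋂ i ∈ (![({1} : Finset (Fin 5)), {2}, {3}, {4}] : Fin 4 → Finset (Fin 5)) j, U i))
      = ![ind (U 1), ind (U 2), ind (U 3), ind (U 4)] := by
    funext j; fin_cases j <;> simp
  have r5 := hU.row_off e hUe 5 ![({0} : Finset (Fin 5)), {1}, {2}, {3}, {4}]
  rw [eU] at r5
  have r4 := (hU.row_off e hUe 4 ![({1} : Finset (Fin 5)), {2}, {3}, {4}]).mono (deg_off_mono e (show 4 ≤ 5 by norm_num))
  rw [eV] at r4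
  have d : (Pi.single e 1 + update (fun _ : ι => 5) e 0) ≤ fun _ : ι => 5 := fun x => by
    by_cases hx : x = e
    · subst hx; simp
    · simp [hx]
  have s0 := (SahiCombDisjunct.combPos_coord_pow e 0 1).mul_of_le r5 d
  have s1 := (SahiCombDisjunct.combPos_coord_pow e 1 0).mul_of_le (r4.smul (by norm_num : (0:ℝ) ≤ 3)) d
  have esel : (sel (0 : Fin 5)) = ![true, false, false, false, false] := by
    funext j; fin_cases j <;> rfl
  have efam : (fun j => ind (SahiMixture.orCoin (U j) ((![true, false, false, false, false] : Fin 5 → Bool) j)))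
      = ![ind (SahiMixture.orCoin (U 0) true), ind (SahiMixture.orCoin (U 1) false), ind (SahiMixture.orCoin (U 2) false),
          ind (SahiMixture.orCoin (U 3) false), ind (SahiMixture.orCoin (U 4) false)] := by
    funext j; fin_cases j <;> rfl
  refine (s0.add s1).congr fun p => ?_
  rw [esel, sahiE_orCoord_eq_coin U e _ hUe p, efam,
    sahiE_five_orCoin_one_eq (sum_bernoulliWeight p) (U 0) (U 1) (U 2) (U 3) (U 4) (p e : ℝ)]
  ring

end Five

/-! ### Relabelling the events so that the touched member is `0` -/

omit [Fintype ι] in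
/-- The selector of `i`, read through the transposition `(0 i)`, is the selector of `0`. [this work] -/
theorem sel_comp_swap (i : Fin 5) : (sel i ∘ Equiv.swap (0 : Fin 5) i) = sel 0 := by
  funext l
  simp only [comp_apply, sel]
  by_cases hl : l = 0
  · subst hl; simp
  · have : Equiv.swap (0 : Fin 5) i l ≠ i := by
      intro h
      have h' := congrArg (Equiv.swap (0 : Fin 5) i) h
      rw [Equiv.swap_apply_self, Equiv.swap_apply_right] at h'
      exact hl h'
    simp [hl, this]

omit [Fintype ι] in
/-- Members of the ∩-closed family of the single-OR-ed family, relabelled. [this work] -/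
theorem biInter_orCoord_sel_swap (U : Fin 5 → Set (Set ι)) (e : ι) (i : Fin 5) (L : Finset (Fin 5)) :
    (⋂ l ∈ L, orCoord U e (sel i) l) = ⋂ l ∈ L.image (Equiv.swap (0 : Fin 5) i), orCoord (U ∘ Equiv.swap (0 : Fin 5) i) e (sel 0) l := by
  have himg : (L.image (Equiv.swap (0 : Fin 5) i)).image (Equiv.swap (0 : Fin 5) i) = L := by
    rw [Finset.image_image]
    have : ((Equiv.swap (0 : Fin 5) i) ∘ (Equiv.swap (0 : Fin 5) i) : Fin 5 → Fin 5) = id := by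
      funext x; simp [Equiv.swap_apply_self]
    rw [this, Finset.image_id]
  conv_lhs => rw [← himg]
  rw [biInter_orCoord_image, sel_comp_swap]

/-! ### The assembly -/

/-- **THE SINGLE-MEMBER OR STEP AT n = 5, FROM THE ORDER-4 CELLS.**  If the order-4 interface holds, then for every finite cube, every quintuple `U` of increasing events
ignoring `e` with `CombHereditary U`, and every member `i`, the family with `e` OR-ed into `U_i` alone is again `CombHereditary`.  Orders `≤ 3`: comb H-MIX(4) on the derived
quadruple `(U_i, Q_0, Q_1, Q_2)`; order `4`: the interface after relabelling by `swap 0 i`; order `5`: singleton slots, the affine (5,1) cell. [this work] -/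
theorem combHereditary_orCoord_five_single_of_cells (h4 : CombFiveSingleFourSlotCells) (U : Fin 5 → Set (Set ι)) (e : ι) (i : Fin 5)
    (hUup : ∀ j, IsUpperSet (U j)) (hUe : ∀ (j : Fin 5) (b : Bool), secAt e b (U j) = U j) (hU : CombHereditary U) :
    CombHereditary (orCoord U e (sel i)) := by
  refine combHereditary_of_irredundant _ fun m K hK => ?_
  have hm : m ≤ 5 := hK.card_le
  have hsec : ∀ (L : Finset (Fin 5)) (b : Bool), secAt e b (⋂ l ∈ L, U l) = ⋂ l ∈ L, U l := fun L b => secAt_biInter U e hUe L b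
  have hsub : ∀ L : Finset (Fin 5), (⋂ l ∈ L, U l) ⊆ ⋂ l ∈ L.filter (fun l => sel i l = false), U l := fun L =>
    Set.biInter_subset_biInter_left (Finset.filter_subset _ L)
  have hcov : ∀ L L' : Finset (Fin 5), CombPos (update (fun _ : ι => 2) e 0)
      (fun p => ex (bernoulliWeight p) (ind (⋂ l ∈ L, U l) * ind (⋂ l ∈ L', U l))
        - ex (bernoulliWeight p) (ind (⋂ l ∈ L, U l)) * ex (bernoulliWeight p) (ind (⋂ l ∈ L', U l))) := by
    intro L L'
    refine (hU.row_off e hUe 2 ![L, L']).congr fun p => ?_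
    rw [sahiE_two_apply]
    simp only [Matrix.cons_val_zero, Matrix.cons_val_one]
  -- the relabelled quintuple `W = U ∘ swap 0 i`
  set π : Equiv.Perm (Fin 5) := Equiv.swap (0 : Fin 5) i with hπ
  have hWup : ∀ j, IsUpperSet ((U ∘ π) j) := fun j => hUup (π j)
  have hWe : ∀ (j : Fin 5) (b : Bool), secAt e b ((U ∘ π) j) = (U ∘ π) j := fun j b => hUe (π j) b
  have hW : CombHereditary (U ∘ π) := hU.reindex π
  interval_cases m
  · exact (CombPos.zero _).congr fun _ => sahiE_zero _ _
  · exact (combPos_ex_ind _).congr fun _ => sahiE_one_apply _ _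
  · have eK : (fun j => ind (⋂ l ∈ K j, orCoord U e (sel i) l)) =
        ![ind (mixCoord e (⋂ l ∈ K 0, U l) (⋂ l ∈ (K 0).filter (fun l => sel i l = false), U l)),
          ind (mixCoord e (⋂ l ∈ K 1, U l) (⋂ l ∈ (K 1).filter (fun l => sel i l = false), U l))] := by
      funext j; fin_cases j <;> simp [biInter_orCoord_eq_mixCoord]
    rw [show (fun p => sahiE (bernoulliWeight p) 2 (fun j => ind (⋂ l ∈ K j, orCoord U e (sel i) l)))
        = fun p => sahiE (bernoulliWeight p) 2 ![ind (mixCoord e (⋂ l ∈ K 0, U l) (⋂ l ∈ (K 0).filter (fun l => sel i l = false), U l)),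
          ind (mixCoord e (⋂ l ∈ K 1, U l) (⋂ l ∈ (K 1).filter (fun l => sel i l = false), U l))] from by rw [eK]]
    exact combPos_two_mixCoord e (hsec _) (hsec _) (hsec _) (hsec _) (hsub _) (hsub _) (hcov _ _) (hcov _ _)
  · -- order 3: the derived quadruple `(U_i, Q_0, Q_1, Q_2)`
    set Q : Fin 3 → Set (Set ι) := fun a => ⋂ l ∈ (K a).erase i, U l with hQ
    set W : Fin 4 → Set (Set ι) := Matrix.vecCons (U i) Q with hWdef
    have hWi : ∀ j, W j = ⋂ l ∈ (Matrix.vecCons ({i} : Finset (Fin 5)) (fun a => (K a).erase i) : Fin 4 → Finset (Fin 5)) j, U l := by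
      intro j
      refine Fin.cases ?_ (fun a => ?_) j
      · simp [hWdef]
      · simp [hWdef, hQ]
    have hW4 : CombHereditary W := hU.of_eq_biInter _ hWi
    have hW4up : ∀ j, IsUpperSet (W j) := fun j => by rw [hWi j]; exact isUpperSet_biInter hUup _
    have hW4e : ∀ (j : Fin 4) (b : Bool), secAt e b (W j) = W j := fun j b => by rw [hWi j]; exact secAt_biInter U e hUe _ b
    have H := combHereditary_orCoord_four W e (sel 0) hW4up hW4e hW4
    set K' : Fin 3 → Finset (Fin 4) := fun a => if i ∈ K a then {0, a.succ} else {a.succ} with hK'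
    refine (H 3 K').congr fun p => ?_
    congr 1
    funext a
    congr 1
    rw [biInter_orCoord_sel U e i (K a)]
    by_cases hi : i ∈ K a
    · have hKa : K' a = {0, a.succ} := by simp [hK', hi]
      rw [hKa, if_pos hi, Finset.set_biInter_insert, Finset.set_biInter_singleton, orCoord_sel_self,
        orCoord_sel_of_ne W e (Fin.succ_ne_zero a), Set.inter_comm]
      simp [hWdef, hQ]
    · have hKa : K' a = {a.succ} := by simp [hK', hi]
      rw [hKa, if_neg hi, Finset.set_biInter_singleton, orCoord_sel_of_ne W e (Fin.succ_ne_zero a), Set.inter_univ]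
      simp [hWdef, hQ]
  · -- order 4: the interface on the relabelled quintuple
    refine (h4 ι (U ∘ π) e hWup hWe hW (fun j => (K j).image π)).congr fun p => ?_
    congr 1
    funext j
    rw [biInter_orCoord_sel_swap U e i (K j)]
  · -- order 5: singleton slots, one of them touched: the affine cell
    obtain ⟨σ, hσ⟩ := exists_perm_of_irredundant hK
    have eK : (fun j => ind (⋂ l ∈ K j, orCoord U e (sel i) l)) = fun j => (fun l => ind (orCoord U e (sel i) l)) (σ j) := by
      funext j; rw [hσ j, Finset.set_biInter_singleton]
    have eW : (fun l => ind (orCoord U e (sel i) l)) = fun l => (fun l' => ind (orCoord (U ∘ π) e (sel 0) l')) (π.symm l) := by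
      funext l
      have h1 := biInter_orCoord_sel_swap U e i {l}
      rw [Finset.image_singleton, Finset.set_biInter_singleton, Finset.set_biInter_singleton] at h1
      simp only
      rw [h1]
      congr 2
    refine (combPos_five_orCoord_one (U ∘ π) e hWe hW).congr fun p => ?_
    rw [eK, sahiE_comp_perm (bernoulliWeight p) 5 σ (fun l => ind (orCoord U e (sel i) l)), eW,
      sahiE_comp_perm (bernoulliWeight p) 5 π.symm (fun l' => ind (orCoord (U ∘ π) e (sel 0) l'))]

/-- Law-level shadow: under the interface, for every product measure the single-OR-ed quintuple is hereditarily all-orders positive. [this work] -/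
theorem hereditaryAllOrders_orCoord_five_single_of_cells (h4 : CombFiveSingleFourSlotCells) (U : Fin 5 → Set (Set ι)) (e : ι) (i : Fin 5)
    (hUup : ∀ j, IsUpperSet (U j)) (hUe : ∀ (j : Fin 5) (b : Bool), secAt e b (U j) = U j) (hU : CombHereditary U) (p : ι → unitInterval) :
    SahiMixture.HereditaryAllOrders (bernoulliWeight p) (orCoord U e (sel i)) :=
  (combHereditary_orCoord_five_single_of_cells h4 U e i hUup hUe hU).hereditaryAllOrders p

end SahiCombMix

end Summit.CriticalPhenomena.PercolationContinuityZ3.Theorems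

end
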